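import Literature.MathematicalPhysics.QuantumLattice.InfVolFermionStateParticleHole
import HarnessLib

/-!
# The particle–hole transform of the LOCAL PAIR: `α(P_x^g) = (P_x^g)ᴴ` for form factors on odd steps, hence
# `Re (ω ∘ α)(P_x^g) = Re ω(P_x^g)`

Topic `MathematicalPhysics/QuantumLattice`. Sequel of `InfVolFermionStateParticleHole` (the staggered particle–hole
automorphism `α`, `c_{xσ} ↦ ε_x c†_{xσ}`, and the state `ω ∘ α`). The local singlet pair of the tree
(`localPairAt S g x = Σ_{e∈S} (g(e)/√2)·(c_{x↑} c_{x+e,↓} − c_{x↓} c_{x+e,↑})`, `InfVolFermionState.lean`) is mapped by `α` to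
`Σ_e (g(e)/√2)·ε_x ε_{x+e}·(c†_{x↑} c†_{x+e,↓} − c†_{x↓} c†_{x+e,↑})`; since two creation operators anticommute,
`(c_{x↑} c_{x+e,↓})ᴴ = −c†_{x↑} c†_{x+e,↓}`, so for steps of stagger `ε_e = −1` (every unit step; the origin carries `g(0) = 0` for
the `d`-wave and extended-`s` form factors) the image is EXACTLY the adjoint (torus twin: `particleHole_mul_localPair_mul_conjTranspose`,
`SoloBlindParticleHoleSymmetry`). Everything is PROVED; no definition, no named fact.

* `phAut_localPairAt` — `α(P_x^g) = (P_x^g)ᴴ` if `g 0 = 0` and `ε_e = −1` for every `e ∈ S` with `g e ≠ 0`;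
  `phAut_localPairAt_dWave` — the `d`-wave pair on `{0} ∪ unitSteps`.
* `InfVolFermionState.particleHole_expect_localPairAt_dWave` — `(ω ∘ α)(P_x^d) = conj ω(P_x^d)`;
  `InfVolFermionState.re_particleHole_expect_localPairAt_dWave` — **`Re (ω ∘ α)(P_x^d) = Re ω(P_x^d)`**: the real part of the
  `d`-wave pair amplitude is particle–hole invariant (the imaginary part flips).

References: E. H. Lieb, PRL 62 (1989) 1201, proof of Thm 2 [LiebPRL1989]; F. H. L. Essler et al., *The One-Dimensional Hubbard
Model* (2005) §2.2.4 (the Shiba transformation on pair operators) [EsslerEtAl2005]; H. Tasaki, *Physics and Mathematics of Quantum Many-Body Systems*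
(2020) §9.3.3 [Tasaki2020].
-/

noncomputable section

namespace Literature.MathematicalPhysics.QuantumLattice

open Matrix Finset HubbardWave0 Literature.Probability.LatticeModels
open scoped ComplexOrder BigOperators

/-! ### §1 The automorphism on the local pair -/

section Pair

/-- One term: `α(c_{x,σ} c_{y,τ}) = −ε_x ε_y (c_{x,σ} c_{y,τ})ᴴ` (two creators anticommute; both sides vanish for equal orbitals).
[cite: LiebPRL1989, proof of Theorem 2] -/
theorem phAut_cAt_mul_cAt {Λ : Finset (Site 2)} {x y : Site 2} (hx : x ∈ Λ) (hy : y ∈ Λ) (σ τ : Fin 2) :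
    phAut Λ (cAt x hx σ * cAt y hy τ) =
      -((((siteStagger x : ℤˣ) : ℤ) : ℂ) * (((siteStagger y : ℤˣ) : ℤ) : ℂ)) • (cAt x hx σ * cAt y hy τ)ᴴ := by
  rw [map_mul, phAut_cAt, phAut_cAt, smul_mul_smul, conjTranspose_mul, cAt, cAt, annihilation_conjTranspose,
    annihilation_conjTranspose, creation_mul_creation_eq_neg (orb (PolySite.pt x hx) σ), smul_neg, neg_smul]

/-- **`α(P_x^g) = (P_x^g)ᴴ`** for a real form factor with `g 0 = 0` supported on steps of stagger `−1` (all unit steps).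
[cite: LiebPRL1989, proof of Theorem 2] [cite: EsslerEtAl2005, §2.2.4] -/
theorem phAut_localPairAt (S : Finset (Site 2)) (g : Site 2 → ℝ) (x : Site 2) (hg0 : g 0 = 0)
    (hS : ∀ e ∈ S, g e ≠ 0 → siteStagger e = -1) :
    phAut (pairRegion S x) (localPairAt S g x) = (localPairAt S g x)ᴴ := by
  rw [localPairAt, map_sum, conjTranspose_sum]
  refine Finset.sum_congr rfl fun e _ => ?_
  by_cases hge : g e.1 = 0
  · simp [hge]
  have he0 : e.1 ≠ 0 := fun h => hge (by rw [h, hg0])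
  have hε : (((siteStagger x : ℤˣ) : ℤ) : ℂ) * (((siteStagger (x + e.1) : ℤˣ) : ℤ) : ℂ) = -1 := by
    rw [siteStagger_add, hS e.1 e.2 hge, Units.val_mul, Units.val_neg, Units.val_one, mul_neg, mul_one, Int.cast_neg,
      mul_neg, ← Int.cast_mul, ← Units.val_mul, Int.units_mul_self, Units.val_one, Int.cast_one]
  rw [map_smul, map_sub, phAut_cAt_mul_cAt, phAut_cAt_mul_cAt, hε, neg_neg, one_smul, one_smul,
    conjTranspose_smul, conjTranspose_sub]
  congr 1
  rw [Complex.star_def, Complex.conj_ofReal]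

/-- Every unit step of `ℤ²` has stagger `−1`. [cite: LiebPRL1989, proof of Theorem 2] -/
theorem siteStagger_of_mem_unitSteps {e : Site 2} (he : e ∈ unitSteps) : siteStagger e = -1 := by
  simp only [unitSteps, Finset.mem_insert, Finset.mem_singleton] at he
  rcases he with rfl | rfl | rfl | rfl
  · exact siteStagger_single_one 0
  · rw [siteStagger_neg]; exact siteStagger_single_one 0
  · exact siteStagger_single_one 1
  · rw [siteStagger_neg]; exact siteStagger_single_one 1

/-- **The `d`-wave local pair on `{0} ∪ unitSteps`: `α(P_x^d) = (P_x^d)ᴴ`.** [cite: LiebPRL1989, proof of Theorem 2] [cite: EsslerEtAl2005, §2.2.4] -/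
theorem phAut_localPairAt_dWave (x : Site 2) :
    phAut (pairRegion (insert (0 : Site 2) unitSteps) x) (localPairAt (insert (0 : Site 2) unitSteps) dWaveFormFactor x) =
      (localPairAt (insert (0 : Site 2) unitSteps) dWaveFormFactor x)ᴴ := by
  refine phAut_localPairAt _ _ x dWaveFormFactor_zero fun e he hge => ?_
  rcases Finset.mem_insert.1 he with rfl | he'
  · exact absurd dWaveFormFactor_zero hge
  · exact siteStagger_of_mem_unitSteps he'

end Pair

/-! ### §2 The pair amplitude of the transformed state -/

namespace InfVolFermionState

variable (ω : InfVolFermionState 2)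

/-- `(ω ∘ α)(P_x^d) = conj ω(P_x^d)` (states are Hermitian). [cite: LiebPRL1989, proof of Theorem 2] -/
theorem particleHole_expect_localPairAt_dWave (x : Site 2) :
    ω.particleHole.expect (pairRegion (insert (0 : Site 2) unitSteps) x)
        (localPairAt (insert (0 : Site 2) unitSteps) dWaveFormFactor x) =
      star (ω.expect (pairRegion (insert (0 : Site 2) unitSteps) x)
        (localPairAt (insert (0 : Site 2) unitSteps) dWaveFormFactor x)) := by
  rw [particleHole_expect, phAut_localPairAt_dWave, ω.expect_conjTranspose]

/-- **The real part of the `d`-wave pair amplitude is particle–hole invariant**: `Re (ω ∘ α)(P_x^d) = Re ω(P_x^d)`.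
[cite: LiebPRL1989, proof of Theorem 2] [cite: EsslerEtAl2005, §2.2.4] -/
theorem re_particleHole_expect_localPairAt_dWave (x : Site 2) :
    (ω.particleHole.expect (pairRegion (insert (0 : Site 2) unitSteps) x)
        (localPairAt (insert (0 : Site 2) unitSteps) dWaveFormFactor x)).re =
      (ω.expect (pairRegion (insert (0 : Site 2) unitSteps) x)
        (localPairAt (insert (0 : Site 2) unitSteps) dWaveFormFactor x)).re := by
  rw [particleHole_expect_localPairAt_dWave, Complex.star_def, Complex.conj_re]

end InfVolFermionState

end Literature.MathematicalPhysics.QuantumLattice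

end
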